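import Literature.Topology.FourManifolds.SurgeryGlueData
import Literature.Topology.FourManifolds.EquidimensionalEmbedding
import Literature.Topology.FourManifolds.ImmersionCriterion
import HarnessLib

/-!
# A reconstruction datum with only matched balls identifies the manifold with a component of the next stage

Last step of the reconstruction of a manifold from the pieces of the Ricci flow with surgery
(R. Hamilton, *Four-manifolds with positive isotropic curvature*, Comm. Anal. Geom. 5 (1997),
§1.1 pp. 3–4; `SurgeryGlueData.lean`): when a reconstruction datum `G` of a compact manifold `Q`
over `M'` has **no tube pieces and no unmatched ball pieces left**, the identification `e` of the
common parts extends over the matched balls — on the chart of a matched ball by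
`ι x ↦ ι' (h̃ ‖x‖ • x/‖x‖)`, where `h̃` is the matching profile `h` bent to be linear near `0`
(`matchBlend`) — to an **injective local diffeomorphism `F : Q → M'`**
(`SurgeryGlueData.glueMap`, smooth with injective differential everywhere, injective by the
disjointness of the deep parts of the surgery balls, `mballM_deep`, `disjoint_footM'`). Its image
is open and compact, hence a union of components of `M'`, and `Q` is diffeomorphic to it
(`SurgeryGlueData.exists_diffeomorph_opens`): this is the statement "`M_k` (cut along its necks)
is recovered from `M_{k+1}`" used in the induction over the surgeries.

## References

* R. S. Hamilton, *Four-manifolds with positive isotropic curvature*, Comm. Anal. Geom. 5 (1997)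
  1–92, §1.1 pp. 3–4. [Hamilton1997]
* M. W. Hirsch, *Differential Topology* (1976), Ch. 1 §3 (equidimensional immersions). [HirschDT1976]
-/

open scoped Manifold ContDiff Topology
open Set Function Metric Module Filter OpenPartialHomeomorph Topology

noncomputable section

namespace Literature.Topology.FourManifolds

open CollarProfile TubeProfile

/-! ### Bending a profile to be linear near `0` -/

section Blend

/-- **The bent profile** `h̃ s = (1 - χ s) (h(1/4) s) + χ s · h s` (`χ = capCut`: `0` on `s ≤ 1/4`,
`1` on `s ≥ 1/2`). [folklore] -/
def matchBlend (h : ℝ → ℝ) (s : ℝ) : ℝ := (1 - capCut s) * (h (1 / 4) * s) + capCut s * h s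

variable {h : ℝ → ℝ} (hc : ContDiff ℝ ∞ h) (hm : StrictMono h) (hd : ∀ s, 0 < deriv h s) (hp : ∀ s, 0 < s → 0 < h s)

/-- `h̃ s = h(1/4) s` for `s ≤ 1/4`. [folklore] -/
theorem matchBlend_of_le {s : ℝ} (hs : s ≤ 1 / 4) : matchBlend h s = h (1 / 4) * s := by
  rw [matchBlend, capCut_of_le hs]; ring

/-- `h̃ s = h s` for `s ≥ 1/2`. [folklore] -/
theorem matchBlend_of_ge {s : ℝ} (hs : 1 / 2 ≤ s) : matchBlend h s = h s := by
  rw [matchBlend, capCut_of_ge hs]; ring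

include hc in
/-- `h̃` is smooth. [folklore] -/
theorem contDiff_matchBlend : ContDiff ℝ ∞ (matchBlend h) := by
  unfold matchBlend
  exact ((contDiff_const.sub contDiff_capCut).mul (contDiff_const.mul contDiff_id)).add (contDiff_capCut.mul hc)

include hc hm hd hp in
/-- **`h̃' > 0`**: `(1-χ) h(1/4) + χ h' + χ' (h s - h(1/4) s) > 0`, the last term being nonnegative on
the transition zone `[1/4, 1/2]` where `h s ≥ h (1/4) ≥ h(1/4) s`. [folklore] -/
theorem deriv_matchBlend_pos (s : ℝ) : 0 < deriv (matchBlend h) s := by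
  have hχ := hasDerivAt_capCut s
  have hh : HasDerivAt h (deriv h s) s := (hc.differentiable (by simp) s).hasDerivAt
  have hA : HasDerivAt (fun s => (1 - capCut s) * (h (1 / 4) * s))
      ((0 - deriv Real.smoothTransition (4 * s - 1) * 4) * (h (1 / 4) * s) + (1 - capCut s) * (h (1 / 4) * 1)) s :=
    ((hasDerivAt_const s (1 : ℝ)).sub hχ).mul ((hasDerivAt_id s).const_mul (h (1 / 4)))
  have hB : HasDerivAt (fun s => capCut s * h s) (deriv Real.smoothTransition (4 * s - 1) * 4 * h s + capCut s * deriv h s) s :=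
    hχ.mul hh
  have hsum : HasDerivAt (matchBlend h) _ s := hA.add hB
  rw [hsum.deriv]
  have hχ0 := capCut_nonneg s
  have hχ1 := capCut_le_one s
  have hdst : 0 ≤ deriv Real.smoothTransition (4 * s - 1) := deriv_smoothTransition_nonneg _
  have hc4 : 0 < h (1 / 4) := hp _ (by norm_num)
  have hds := hd s
  -- the cut-off term vanishes off `(1/4, 1/2)` and is nonnegative on it
  have hcut : 0 ≤ deriv Real.smoothTransition (4 * s - 1) * 4 * (h s - h (1 / 4) * s) := by
    rcases le_or_gt s (1 / 4) with h14 | h14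
    · have : 4 * s - 1 ≤ 0 := by linarith
      rcases this.lt_or_eq with hlt | heq
      · rw [deriv_smoothTransition_of_neg hlt]; simp
      · -- at `s = 1/4` the gap `h s - h(1/4) s` is nonnegative
        have hs : s = 1 / 4 := by linarith
        subst hs
        refine mul_nonneg (mul_nonneg hdst (by norm_num)) ?_
        nlinarith
    · rcases lt_or_ge (1 / 2) s with h12 | h12
      · rw [deriv_smoothTransition_of_one_lt (by linarith)]; simp
      · refine mul_nonneg (mul_nonneg hdst (by norm_num)) ?_
        have : h (1 / 4) ≤ h s := hm.monotone h14.le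
        nlinarith
  have hblend : 0 < (1 - capCut s) * h (1 / 4) + capCut s * deriv h s := by
    rcases hχ1.lt_or_eq with hlt | heq
    · exact add_pos_of_pos_of_nonneg (mul_pos (by linarith) hc4) (mul_nonneg hχ0 hds.le)
    · rw [heq]; simpa using hds
  nlinarith

include hc hm hd hp in
/-- `h̃` is strictly increasing, hence injective. [folklore] -/
theorem strictMono_matchBlend : StrictMono (matchBlend h) :=
  strictMono_of_deriv_pos (deriv_matchBlend_pos hc hm hd hp)

/-- The inverse bent profile. [folklore] -/
def matchBlendInv (h : ℝ → ℝ) : ℝ → ℝ := invFun (matchBlend h)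

include hc hm hd hp in
/-- `h̃⁻¹ (h̃ s) = s`. [folklore] -/
theorem matchBlendInv_matchBlend (s : ℝ) : matchBlendInv h (matchBlend h s) = s :=
  leftInverse_invFun (strictMono_matchBlend hc hm hd hp).injective s

include hc hm hd hp in
/-- `h̃⁻¹` is smooth at `h̃ s`. [folklore] -/
theorem contDiffAt_matchBlendInv (s : ℝ) : ContDiffAt ℝ ∞ (matchBlendInv h) (matchBlend h s) :=
  contDiffAt_leftInverse_of_hasDerivAt (contDiff_matchBlend hc).contDiffAt
    (((contDiff_matchBlend hc).differentiable (by simp)) s).hasDerivAt (deriv_matchBlend_pos hc hm hd hp s).ne' (by simp)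
    (leftInverse_invFun (strictMono_matchBlend hc hm hd hp).injective)

include hp in
/-- `0 < h̃ s` for `s > 0`. [folklore] -/
theorem matchBlend_pos {s : ℝ} (hs : 0 < s) : 0 < matchBlend h s := by
  rw [matchBlend]
  have hc4 : 0 < h (1 / 4) := hp _ (by norm_num)
  have hχ0 := capCut_nonneg s
  have hχ1 := capCut_le_one s
  rcases le_or_gt s (1 / 4) with h14 | h14
  · rw [capCut_of_le h14]; nlinarith
  · have : 0 < h s := hp s hs
    rcases hχ1.lt_or_eq with hlt | heq
    · nlinarith [mul_pos (sub_pos.2 hlt) (mul_pos hc4 hs)]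
    · rw [heq]; linarith

end Blend

/-! ### The bent radial map -/

section BlendRadial

variable {E : Type*} [NormedAddCommGroup E] [InnerProductSpace ℝ E] {h : ℝ → ℝ}
  (hc : ContDiff ℝ ∞ h) (hm : StrictMono h) (hd : ∀ s, 0 < deriv h s) (hp : ∀ s, 0 < s → 0 < h s)

/-- The bent radial map `x ↦ h̃ ‖x‖ • x/‖x‖`. [folklore] -/
def blendMap (h : ℝ → ℝ) : E → E := radialMap (matchBlend h)

/-- Its inverse (near the image). [folklore] -/
def blendMapInv (h : ℝ → ℝ) : E → E := radialMap (matchBlendInv h)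

/-- Near `0` the bent radial map is the homothety of ratio `h (1/4)`. [folklore] -/
theorem blendMap_eq_smul_of_norm_lt {x : E} (hx : ‖x‖ < 1 / 4) : blendMap h x = h (1 / 4) • x :=
  radialMap_eq_smul_of_norm_lt _ (fun _ _ ht => matchBlend_of_le ht.le) hx

/-- Off `B(0, 1/2)` the bent radial map is the matching radial map. [folklore] -/
theorem blendMap_eq_radialMap {x : E} (hx : 1 / 2 ≤ ‖x‖) : blendMap h x = radialMap h x := by
  rw [blendMap, radialMap, radialMap, matchBlend_of_ge hx]

include hp in
/-- `‖blendMap x‖ = h̃ ‖x‖`. [folklore] -/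
theorem norm_blendMap (x : E) : ‖blendMap h x‖ = matchBlend h ‖x‖ := by
  rcases eq_or_ne x 0 with rfl | hx
  · simp [blendMap, radialMap, matchBlend_of_le (show (0 : ℝ) ≤ 1 / 4 by norm_num)]
  · rw [blendMap, norm_radialMap _ hx, abs_of_pos (matchBlend_pos hp (norm_pos_iff.2 hx))]

include hc in
/-- The bent radial map is smooth. [folklore] -/
theorem contDiff_blendMap : ContDiff ℝ ∞ (blendMap h : E → E) := by
  rw [contDiff_iff_contDiffAt]
  intro x
  rcases eq_or_ne x 0 with rfl | hx
  · have hev : (blendMap h : E → E) =ᶠ[𝓝 0] fun x => h (1 / 4) • x :=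
      Filter.eventuallyEq_of_mem (ball_mem_nhds (0 : E) (by norm_num : (0 : ℝ) < 1 / 4)) fun w hw =>
        blendMap_eq_smul_of_norm_lt (by simpa using hw)
    exact (contDiffAt_const.smul contDiffAt_id).congr_of_eventuallyEq hev
  · exact contDiffAt_radialMap hx (contDiff_matchBlend hc).contDiffAt

include hc hm hd hp in
/-- `blendMapInv (blendMap x) = x`. [folklore] -/
theorem blendMapInv_blendMap (x : E) : blendMapInv h (blendMap h x) = x := by
  rcases eq_or_ne x 0 with rfl | hx
  · simp [blendMap, blendMapInv, radialMap]
  · rw [blendMapInv, blendMap, radialMap_radialMap _ _ hx (matchBlend_pos hp (norm_pos_iff.2 hx)),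
      matchBlendInv_matchBlend hc hm hd hp, mul_inv_cancel₀ (norm_ne_zero_iff.2 hx), one_smul]

include hc hm hd hp in
/-- The bent radial map is injective. [folklore] -/
theorem injective_blendMap : Injective (blendMap h : E → E) := LeftInverse.injective (blendMapInv_blendMap hc hm hd hp)

include hc hm hd hp in
/-- The inverse is smooth at the points of the image. [folklore] -/
theorem contDiffAt_blendMapInv (x : E) : ContDiffAt ℝ ∞ (blendMapInv h : E → E) (blendMap h x) := by
  rcases eq_or_ne x 0 with rfl | hx
  · have h0 : blendMap h (0 : E) = 0 := by simp [blendMap, radialMap]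
    rw [h0]
    have hc4 : 0 < h (1 / 4) := hp _ (by norm_num)
    -- near `0`, `blendMapInv = (h(1/4))⁻¹ • id`
    have hev : (blendMapInv h : E → E) =ᶠ[𝓝 0] fun y => (h (1 / 4))⁻¹ • y := by
      have hr : 0 < h (1 / 4) * (1 / 4) := by positivity
      refine Filter.eventuallyEq_of_mem (ball_mem_nhds (0 : E) hr) fun y hy => ?_
      have hy' : ‖y‖ < h (1 / 4) * (1 / 4) := by simpa using hy
      refine radialMap_eq_smul_of_norm_lt _ (fun t _ ht => ?_) hy'
      have : matchBlend h ((h (1 / 4))⁻¹ * t) = t := by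
        rw [matchBlend_of_le]; · field_simp
        rw [inv_mul_le_iff₀ hc4]; linarith
      conv_lhs => rw [← this]
      exact matchBlendInv_matchBlend hc hm hd hp _
    exact (contDiffAt_const.smul contDiffAt_id).congr_of_eventuallyEq hev
  · have hne : blendMap h x ≠ 0 := by
      rw [← norm_pos_iff, norm_blendMap hp]; exact matchBlend_pos hp (norm_pos_iff.2 hx)
    refine contDiffAt_radialMap hne ?_
    rw [norm_blendMap hp]
    exact contDiffAt_matchBlendInv hc hm hd hp _

include hc hm hd hp in
/-- The differential of the bent radial map is injective. [folklore] -/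
theorem injective_fderiv_blendMap (x : E) : Injective (fderiv ℝ (blendMap h : E → E) x) := by
  have hf : HasFDerivAt (blendMap h : E → E) (fderiv ℝ (blendMap h) x) x :=
    (((contDiff_blendMap hc).contDiffAt (x := x)).differentiableAt (by simp)).hasFDerivAt
  have hg : HasFDerivAt (blendMapInv h : E → E) (fderiv ℝ (blendMapInv h) (blendMap h x)) (blendMap h x) :=
    ((contDiffAt_blendMapInv hc hm hd hp x).differentiableAt (by simp)).hasFDerivAt
  have hcomp := hg.comp x hf
  have hid : HasFDerivAt (blendMapInv h ∘ blendMap h : E → E) (ContinuousLinearMap.id ℝ E) x := by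
    rw [show (blendMapInv h ∘ blendMap h : E → E) = id from funext (blendMapInv_blendMap hc hm hd hp)]
    exact hasFDerivAt_id x
  have heq := hcomp.unique hid
  intro v w hvw
  have := congrArg (fderiv ℝ (blendMapInv h) (blendMap h x)) hvw
  rw [← ContinuousLinearMap.comp_apply, ← ContinuousLinearMap.comp_apply, heq] at this
  simpa using this

end BlendRadial

/-! ### The glued map -/

namespace SurgeryGlueData

variable {E : Type} [NormedAddCommGroup E] [InnerProductSpace ℝ E] {n : ℕ} [Fact (finrank ℝ E = n + 1)]
  {Q M' : Type} [TopologicalSpace Q] [ChartedSpace E Q] [TopologicalSpace M'] [ChartedSpace E M']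
  (G : SurgeryGlueData E n Q M')

/-- The chart of a matched ball as an open partial homeomorphism. [folklore] -/
def mballPH (k : G.P.Im) : OpenPartialHomeomorph E Q :=
  haveI : Nonempty E := ⟨0⟩
  (G.P.isOpenEmbedding_mball k).toOpenPartialHomeomorph _

/-- `mballPH_coe`: elementary bookkeeping (mballPH coe). [folklore] -/
@[simp] theorem mballPH_coe (k : G.P.Im) : ⇑(G.mballPH k) = G.P.mball k := rfl

/-- `mballPH_symm_mball`: elementary bookkeeping (mballPH symm mball). [folklore] -/
theorem mballPH_symm_mball (k : G.P.Im) (x : E) : (G.mballPH k).symm (G.P.mball k x) = x := by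
  haveI : Nonempty E := ⟨0⟩
  exact IsOpenEmbedding.toOpenPartialHomeomorph_left_inv _ _

/-- `mball_mballPH_symm`: elementary bookkeeping (mball mballPH symm). [folklore] -/
theorem mball_mballPH_symm (k : G.P.Im) {p : Q} (hp : p ∈ range (G.P.mball k)) : G.P.mball k ((G.mballPH k).symm p) = p := by
  haveI : Nonempty E := ⟨0⟩
  exact IsOpenEmbedding.toOpenPartialHomeomorph_right_inv _ _ hp

/-- `contMDiffOn_mballPH_symm`: elementary bookkeeping (contMDiffOn mballPH symm). [folklore] -/
theorem contMDiffOn_mballPH_symm [IsManifold 𝓘(ℝ, E) ∞ Q] (k : G.P.Im) :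
    ContMDiffOn 𝓘(ℝ, E) 𝓘(ℝ, E) ∞ (G.mballPH k).symm (range (G.P.mball k)) := by
  haveI : Nonempty E := ⟨0⟩
  exact contMDiffOn_symm_of_isSmoothEmbedding (G.P.isSmoothEmbedding_mball k) (G.P.isOpenEmbedding_mball k)

/-- The local formula on the chart of a matched ball: `ι' ∘ blendMap ∘ ι⁻¹`. [folklore] -/
def pieceMap (k : G.P.Im) (p : Q) : M' := G.P.mballM k (blendMap (G.P.mprof k) ((G.mballPH k).symm p))

/-- `pieceMap_mball`: elementary bookkeeping (pieceMap mball). [folklore] -/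
theorem pieceMap_mball (k : G.P.Im) (x : E) : G.pieceMap k (G.P.mball k x) = G.P.mballM k (blendMap (G.P.mprof k) x) := by
  rw [pieceMap, mballPH_symm_mball]

/-- Ranges of distinct matched balls are disjoint. [folklore] -/
theorem disjoint_range_mball {k k' : G.P.Im} (h : k ≠ k') : Disjoint (range (G.P.mball k)) (range (G.P.mball k')) :=
  G.disjoint_foot (Sum.inr (Sum.inr k)) (Sum.inr (Sum.inr k')) (by simpa using h)

/-- The matched ball containing a point of a range is unique. [folklore] -/
theorem eq_of_mem_range {k k' : G.P.Im} {p : Q} (hk : p ∈ range (G.P.mball k)) (hk' : p ∈ range (G.P.mball k')) : k = k' := by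
  by_contra h; exact Set.disjoint_left.1 (G.disjoint_range_mball h) hk hk'

open Classical in
/-- **The glued map** `F : Q → M'`: `e` off the matched balls, `ι' ∘ blendMap ∘ ι⁻¹` on them. [folklore] -/
def glueMap (p : Q) : M' := if h : ∃ k, p ∈ range (G.P.mball k) then G.pieceMap h.choose p else G.P.e p

/-- On the range of a matched ball, `F` is the local formula. [folklore] -/
theorem glueMap_of_mem_range {k : G.P.Im} {p : Q} (hp : p ∈ range (G.P.mball k)) : G.glueMap p = G.pieceMap k p := by
  classical
  have h : ∃ k, p ∈ range (G.P.mball k) := ⟨k, hp⟩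
  rw [glueMap, dif_pos h, G.eq_of_mem_range h.choose_spec hp]

/-- `glueMap_mball`: elementary bookkeeping (glueMap mball). [folklore] -/
theorem glueMap_mball (k : G.P.Im) (x : E) : G.glueMap (G.P.mball k x) = G.P.mballM k (blendMap (G.P.mprof k) x) := by
  rw [G.glueMap_of_mem_range ⟨x, rfl⟩, pieceMap_mball]

/-- Off the ranges, `F = e`. [folklore] -/
theorem glueMap_of_forall_not_mem {p : Q} (hp : ∀ k, p ∉ range (G.P.mball k)) : G.glueMap p = G.P.e p := by
  classical
  rw [glueMap, dif_neg (not_exists.2 hp)]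

/-- On the shallow part of a matched ball `F = e` (radial matching). [folklore] -/
theorem glueMap_mball_of_ge (k : G.P.Im) {x : E} (hx : 1 / 2 ≤ ‖x‖) :
    G.glueMap (G.P.mball k x) = G.P.e (G.P.mball k x) ∧ G.P.mball k x ∈ G.P.e.source := by
  have hx0 : x ≠ 0 := by rintro rfl; rw [norm_zero] at hx; norm_num at hx
  obtain ⟨h1, h2⟩ := G.mball_match k x hx0
  rw [glueMap_mball, blendMap_eq_radialMap hx, h2]
  exact ⟨rfl, h1⟩

variable [hIt : IsEmpty G.P.It] [hIb : IsEmpty G.P.Ib]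

/-- With no tubes and no balls, a point off the ranges of the matched balls is in the common
part. [folklore] -/
theorem mem_N_of_forall_not_mem {p : Q} (hp : ∀ k, p ∉ range (G.P.mball k)) : p ∈ G.P.N := by
  rw [GluePieces.mem_N_iff]
  rintro (i | j | k) h
  · exact hIt.elim i
  · exact hIb.elim j
  · exact hp k (G.P.pieceM_subset_foot k h)

/-- **`F = e` on the common part and the shallow parts**, precisely off the compact deep set
`⋃ ι (B̄(0, 1/2))`. [folklore] -/
theorem glueMap_eq_e {p : Q} (hp : p ∉ ⋃ k, G.P.mball k '' closedBall 0 (1 / 2)) :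
    G.glueMap p = G.P.e p ∧ p ∈ G.P.e.source := by
  by_cases h : ∃ k, p ∈ range (G.P.mball k)
  · obtain ⟨k, x, rfl⟩ := h
    have hx : 1 / 2 ≤ ‖x‖ := by
      by_contra hlt
      exact hp (mem_iUnion.2 ⟨k, x, mem_closedBall_zero_iff.2 (le_of_lt (not_le.1 hlt)), rfl⟩)
    exact G.glueMap_mball_of_ge k hx
  · push Not at h
    exact ⟨G.glueMap_of_forall_not_mem h, G.N_subset_source (G.mem_N_of_forall_not_mem h)⟩

omit hIt hIb in
/-- The deep set is compact. [folklore] -/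
theorem isCompact_deep : IsCompact (⋃ k, G.P.mball k '' closedBall (0 : E) (1 / 2)) := by
  haveI : FiniteDimensional ℝ E := .of_fact_finrank_eq_succ (K := ℝ) (V := E) n
  exact isCompact_iUnion fun k => (isCompact_closedBall _ _).image (G.P.continuous_mball k)

/-! #### Smoothness -/

variable [IsManifold 𝓘(ℝ, E) ∞ Q]

omit hIt hIb in
/-- The local formula is smooth on the range. [folklore] -/
theorem contMDiffOn_pieceMap (k : G.P.Im) : ContMDiffOn 𝓘(ℝ, E) 𝓘(ℝ, E) ∞ (G.pieceMap k) (range (G.P.mball k)) := by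
  have h1 : ContMDiff 𝓘(ℝ, E) 𝓘(ℝ, E) ∞ (fun x : E => G.P.mballM k (blendMap (G.P.mprof k) x)) :=
    (G.P.isSmoothEmbedding_mballM k).contMDiff.comp (contMDiff_iff_contDiff.2 (contDiff_blendMap (G.P.contDiff_mprof k)))
  exact h1.comp_contMDiffOn (G.contMDiffOn_mballPH_symm k)

omit hIt hIb in
/-- `F` is smooth at the points of the ranges. [folklore] -/
theorem contMDiffAt_glueMap_of_mem_range {k : G.P.Im} {p : Q} (hp : p ∈ range (G.P.mball k)) :
    ContMDiffAt 𝓘(ℝ, E) 𝓘(ℝ, E) ∞ G.glueMap p := by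
  have hev : G.glueMap =ᶠ[𝓝 p] G.pieceMap k :=
    Filter.eventuallyEq_of_mem ((G.P.isOpen_range_mball k).mem_nhds hp) fun q hq => G.glueMap_of_mem_range hq
  exact ((G.contMDiffOn_pieceMap k).contMDiffAt ((G.P.isOpen_range_mball k).mem_nhds hp)).congr_of_eventuallyEq hev

omit [IsManifold 𝓘(ℝ, E) ∞ Q] in
/-- `F` is smooth at the points off the deep set (where it is `e`). [folklore] -/
theorem contMDiffAt_glueMap_of_not_mem_deep [T2Space Q] {p : Q} (hp : p ∉ ⋃ k, G.P.mball k '' closedBall 0 (1 / 2)) :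
    ContMDiffAt 𝓘(ℝ, E) 𝓘(ℝ, E) ∞ G.glueMap p := by
  have hW : (⋃ k, G.P.mball k '' closedBall (0 : E) (1 / 2))ᶜ ∈ 𝓝 p := G.isCompact_deep.isClosed.isOpen_compl.mem_nhds hp
  have hev : G.glueMap =ᶠ[𝓝 p] G.P.e := Filter.eventuallyEq_of_mem hW fun q hq => (G.glueMap_eq_e hq).1
  exact (G.P.contMDiffOn_e.contMDiffAt (G.P.e.open_source.mem_nhds (G.glueMap_eq_e hp).2)).congr_of_eventuallyEq hev

/-- **`F` is smooth.** [folklore] -/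
theorem contMDiff_glueMap [T2Space Q] : ContMDiff 𝓘(ℝ, E) 𝓘(ℝ, E) ∞ G.glueMap := fun p => by
  by_cases h : ∃ k, p ∈ range (G.P.mball k)
  · obtain ⟨k, hk⟩ := h; exact G.contMDiffAt_glueMap_of_mem_range hk
  · push Not at h
    refine G.contMDiffAt_glueMap_of_not_mem_deep fun hp => ?_
    obtain ⟨k, x, -, hx⟩ := mem_iUnion.1 hp
    exact h k ⟨x, hx⟩

/-! #### Injectivity of the differential -/

omit hIt hIb in
/-- `1 ≤ ∞`. [folklore] -/
theorem one_le_infty' : (1 : WithTop ℕ∞) ≤ ∞ := by exact_mod_cast le_top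

omit hIt hIb in
/-- The differential of the local formula is injective. [folklore] -/
theorem injective_mfderiv_pieceMap (k : G.P.Im) (x : E) :
    Injective (mfderiv 𝓘(ℝ, E) 𝓘(ℝ, E) (G.pieceMap k) (G.P.mball k x)) := by
  -- `pieceMap ∘ mball = mballM ∘ blendMap`, and `mball` has surjective (indeed bijective) differential
  have hR : MDifferentiableAt 𝓘(ℝ, E) 𝓘(ℝ, E) (blendMap (G.P.mprof k) : E → E) x :=
    (contMDiff_iff_contDiff.2 (contDiff_blendMap (G.P.contDiff_mprof k)) x).mdifferentiableAt (by simp)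
  have hM : MDifferentiableAt 𝓘(ℝ, E) 𝓘(ℝ, E) (G.P.mballM k) (blendMap (G.P.mprof k) x) :=
    (G.P.isSmoothEmbedding_mballM k).contMDiff.mdifferentiableAt (by simp)
  have hι : MDifferentiableAt 𝓘(ℝ, E) 𝓘(ℝ, E) (G.P.mball k) x := (G.P.isSmoothEmbedding_mball k).contMDiff.mdifferentiableAt (by simp)
  have hP : MDifferentiableAt 𝓘(ℝ, E) 𝓘(ℝ, E) (G.pieceMap k) (G.P.mball k x) :=
    ((G.contMDiffOn_pieceMap k).contMDiffAt ((G.P.isOpen_range_mball k).mem_nhds ⟨x, rfl⟩)).mdifferentiableAt (by simp)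
  have hcomp1 : mfderiv 𝓘(ℝ, E) 𝓘(ℝ, E) (G.pieceMap k ∘ G.P.mball k) x =
      (mfderiv 𝓘(ℝ, E) 𝓘(ℝ, E) (G.pieceMap k) (G.P.mball k x)).comp (mfderiv 𝓘(ℝ, E) 𝓘(ℝ, E) (G.P.mball k) x) :=
    mfderiv_comp x hP hι
  have heq : G.pieceMap k ∘ G.P.mball k = G.P.mballM k ∘ blendMap (G.P.mprof k) := funext fun y => G.pieceMap_mball k y
  have hcomp2 : mfderiv 𝓘(ℝ, E) 𝓘(ℝ, E) (G.P.mballM k ∘ blendMap (G.P.mprof k)) x =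
      (mfderiv 𝓘(ℝ, E) 𝓘(ℝ, E) (G.P.mballM k) (blendMap (G.P.mprof k) x)).comp (mfderiv 𝓘(ℝ, E) 𝓘(ℝ, E) (blendMap (G.P.mprof k)) x) :=
    mfderiv_comp x hM hR
  have hinj2 : Injective (mfderiv 𝓘(ℝ, E) 𝓘(ℝ, E) (G.P.mballM k ∘ blendMap (G.P.mprof k)) x) := by
    rw [hcomp2]
    intro v w hvw
    have hvw' : mfderiv 𝓘(ℝ, E) 𝓘(ℝ, E) (G.P.mballM k) (blendMap (G.P.mprof k) x) (mfderiv 𝓘(ℝ, E) 𝓘(ℝ, E) (blendMap (G.P.mprof k)) x v) =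
        mfderiv 𝓘(ℝ, E) 𝓘(ℝ, E) (G.P.mballM k) (blendMap (G.P.mprof k) x) (mfderiv 𝓘(ℝ, E) 𝓘(ℝ, E) (blendMap (G.P.mprof k)) x w) := hvw
    have h2 := (mfderiv_injective_of_isImmersion (G.P.isSmoothEmbedding_mballM k).isImmersion one_le_infty' _) hvw'
    rw [mfderiv_eq_fderiv] at h2
    exact injective_fderiv_blendMap (G.P.contDiff_mprof k) (G.P.strictMono_mprof k) (G.P.deriv_mprof_pos k) (G.P.mprof_pos k) x h2
  rw [← heq, hcomp1] at hinj2
  -- the differential of `mball` is surjective (local diffeomorphism between equal dimensions)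
  haveI : FiniteDimensional ℝ E := .of_fact_finrank_eq_succ (K := ℝ) (V := E) n
  haveI : FiniteDimensional ℝ (TangentSpace 𝓘(ℝ, E) x) := inferInstanceAs (FiniteDimensional ℝ E)
  haveI : FiniteDimensional ℝ (TangentSpace 𝓘(ℝ, E) (G.P.mball k x)) := inferInstanceAs (FiniteDimensional ℝ E)
  have hsurj : Surjective (mfderiv 𝓘(ℝ, E) 𝓘(ℝ, E) (G.P.mball k) x) := by
    have hinjι := mfderiv_injective_of_isImmersion (G.P.isSmoothEmbedding_mball k).isImmersion one_le_infty' x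
    exact LinearMap.surjective_of_injective (f := (mfderiv 𝓘(ℝ, E) 𝓘(ℝ, E) (G.P.mball k) x).toLinearMap) hinjι
  intro v w hvw
  obtain ⟨v', rfl⟩ := hsurj v
  obtain ⟨w', rfl⟩ := hsurj w
  have : (mfderiv 𝓘(ℝ, E) 𝓘(ℝ, E) (G.pieceMap k) (G.P.mball k x)).comp (mfderiv 𝓘(ℝ, E) 𝓘(ℝ, E) (G.P.mball k) x) v' =
      (mfderiv 𝓘(ℝ, E) 𝓘(ℝ, E) (G.pieceMap k) (G.P.mball k x)).comp (mfderiv 𝓘(ℝ, E) 𝓘(ℝ, E) (G.P.mball k) x) w' := hvw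
  rw [hinj2 this]

/-- **The differential of `F` is injective everywhere.** [folklore] -/
theorem injective_mfderiv_glueMap [T2Space Q] (p : Q) : Injective (mfderiv 𝓘(ℝ, E) 𝓘(ℝ, E) G.glueMap p) := by
  by_cases h : ∃ k, p ∈ range (G.P.mball k)
  · obtain ⟨k, x, rfl⟩ := h
    have hev : G.glueMap =ᶠ[𝓝 (G.P.mball k x)] G.pieceMap k :=
      Filter.eventuallyEq_of_mem ((G.P.isOpen_range_mball k).mem_nhds ⟨x, rfl⟩) fun q hq => G.glueMap_of_mem_range hq
    rw [hev.mfderiv_eq]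
    exact G.injective_mfderiv_pieceMap k x
  · push Not at h
    have hp : p ∉ ⋃ k, G.P.mball k '' closedBall (0 : E) (1 / 2) := fun hp => by
      obtain ⟨k, x, -, hx⟩ := mem_iUnion.1 hp; exact h k ⟨x, hx⟩
    have hW : (⋃ k, G.P.mball k '' closedBall (0 : E) (1 / 2))ᶜ ∈ 𝓝 p := G.isCompact_deep.isClosed.isOpen_compl.mem_nhds hp
    have hev : G.glueMap =ᶠ[𝓝 p] G.P.e := Filter.eventuallyEq_of_mem hW fun q hq => (G.glueMap_eq_e hq).1
    rw [hev.mfderiv_eq]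
    have hps := (G.glueMap_eq_e hp).2
    refine mfderiv_injective_of_eventuallyEq_leftInverse (g := G.P.e.symm)
      ((G.P.contMDiffOn_e.contMDiffAt (G.P.e.open_source.mem_nhds hps)).mdifferentiableAt (by simp))
      ((G.P.contMDiffOn_e_symm.contMDiffAt (G.P.e.open_target.mem_nhds (G.P.e.map_source hps))).mdifferentiableAt (by simp)) ?_
    exact Filter.eventuallyEq_of_mem (G.P.e.open_source.mem_nhds hps) fun q hq => G.P.e.left_inv hq

/-! #### Injectivity -/

omit hIt hIb [IsManifold 𝓘(ℝ, E) ∞ Q] in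
/-- The value of `F` on a deep point is in the deep part of the surgery ball. [folklore] -/
theorem glueMap_mball_mem_deep (k : G.P.Im) {x : E} (hx : ‖x‖ ≤ 1 / 2) :
    G.glueMap (G.P.mball k x) ∈ G.P.mballM k '' closedBall 0 (G.P.mprof k (1 / 2)) := by
  rw [glueMap_mball]
  refine ⟨_, ?_, rfl⟩
  rw [mem_closedBall_zero_iff, norm_blendMap (G.P.mprof_pos k), ← matchBlend_of_ge (h := G.P.mprof k) le_rfl]
  exact (strictMono_matchBlend (G.P.contDiff_mprof k) (G.P.strictMono_mprof k) (G.P.deriv_mprof_pos k) (G.P.mprof_pos k)).monotone hx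

omit hIt hIb [IsManifold 𝓘(ℝ, E) ∞ Q] in
/-- The value of `F = e` on a point of the source off the piece `k` misses the deep part of the
surgery ball `k`. [folklore] -/
theorem glueMap_not_mem_deep {k : G.P.Im} {q : Q} (hq : q ∈ G.P.e.source) (hqk : q ∉ G.P.pieceM k) (hF : G.glueMap q = G.P.e q) :
    G.glueMap q ∉ G.P.mballM k '' closedBall 0 (G.P.mprof k (1 / 2)) := fun h =>
  Set.disjoint_left.1 (G.mballM_deep k) h ⟨q, ⟨hq, hqk⟩, hF.symm⟩

omit hIt hIb [IsManifold 𝓘(ℝ, E) ∞ Q] in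
/-- A shallow or collar point of a matched ball is in the source, off the deep set, and `F = e`
there; it is off the piece `k'` for `k' ≠ k`. [folklore] -/
theorem shallow_facts (k : G.P.Im) {x : E} (hx : 1 / 2 < ‖x‖) :
    G.glueMap (G.P.mball k x) = G.P.e (G.P.mball k x) ∧ G.P.mball k x ∈ G.P.e.source :=
  G.glueMap_mball_of_ge k hx.le

omit [IsManifold 𝓘(ℝ, E) ∞ Q] in
/-- **`F` is injective.** [folklore] -/
theorem injective_glueMap : Injective G.glueMap := by
  intro p q hpq
  -- `F = e` and membership in the source off the deep set
  have key : ∀ {p : Q}, (∀ k x, p = G.P.mball k x → 1 / 2 < ‖x‖) → G.glueMap p = G.P.e p ∧ p ∈ G.P.e.source := by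
    intro p hp
    refine G.glueMap_eq_e fun hmem => ?_
    obtain ⟨k, x, hx, rfl⟩ := mem_iUnion.1 hmem
    exact absurd (mem_closedBall_zero_iff.1 hx) (not_le.2 (hp k x rfl))
  -- a deep point of `k` and a point with `F = e` off the piece `k` cannot have the same image
  have clash : ∀ {k : G.P.Im} {x : E} {q : Q}, ‖x‖ ≤ 1 / 2 → G.glueMap q = G.P.e q → q ∈ G.P.e.source → q ∉ G.P.pieceM k →
      G.glueMap (G.P.mball k x) ≠ G.glueMap q := by
    intro k x q hx hF hq hqk heq
    exact G.glueMap_not_mem_deep hq hqk hF (heq ▸ G.glueMap_mball_mem_deep k hx)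
  by_cases hp : ∃ k x, p = G.P.mball k x ∧ ‖x‖ ≤ 1 / 2 <;> by_cases hq : ∃ k x, q = G.P.mball k x ∧ ‖x‖ ≤ 1 / 2
  · -- both deep
    obtain ⟨k, x, rfl, hx⟩ := hp
    obtain ⟨k', x', rfl, hx'⟩ := hq
    have hkk : k = k' := by
      by_contra hne
      have h1 := G.glueMap_mball_mem_deep k hx
      have h2 := G.glueMap_mball_mem_deep k' hx'
      rw [hpq] at h1
      exact Set.disjoint_left.1 (G.disjoint_footM' (Sum.inr (Sum.inr k)) (Sum.inr (Sum.inr k')) (by simpa using hne)) h1 h2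
    subst hkk
    rw [glueMap_mball, glueMap_mball] at hpq
    rw [injective_blendMap (G.P.contDiff_mprof k) (G.P.strictMono_mprof k) (G.P.deriv_mprof_pos k) (G.P.mprof_pos k)
      (G.P.injective_mballM k hpq)]
  · -- `p` deep, `q` not deep
    obtain ⟨k, x, rfl, hx⟩ := hp
    push Not at hq
    have hq' : ∀ k x, q = G.P.mball k x → 1 / 2 < ‖x‖ := fun k x h => hq k x h
    obtain ⟨hFq, hqs⟩ := key hq'
    by_cases hqk : q ∈ G.P.pieceM k
    · -- `q` is a shallow point of the same ball: compare in the chart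
      obtain ⟨x', hx', rfl⟩ := hqk
      rw [glueMap_mball, glueMap_mball] at hpq
      rw [injective_blendMap (G.P.contDiff_mprof k) (G.P.strictMono_mprof k) (G.P.deriv_mprof_pos k) (G.P.mprof_pos k)
        (G.P.injective_mballM k hpq)]
    · exact absurd hpq (clash hx hFq hqs hqk)
  · obtain ⟨k, x, rfl, hx⟩ := hq
    push Not at hp
    obtain ⟨hFp, hps⟩ := key fun k x h => hp k x h
    by_cases hpk : p ∈ G.P.pieceM k
    · obtain ⟨x', hx', rfl⟩ := hpk
      rw [glueMap_mball, glueMap_mball] at hpq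
      rw [injective_blendMap (G.P.contDiff_mprof k) (G.P.strictMono_mprof k) (G.P.deriv_mprof_pos k) (G.P.mprof_pos k)
        (G.P.injective_mballM k hpq)]
    · exact absurd hpq.symm (clash hx hFp hps hpk)
  · push Not at hp hq
    obtain ⟨hFp, hps⟩ := key fun k x h => hp k x h
    obtain ⟨hFq, hqs⟩ := key fun k x h => hq k x h
    rw [hFp, hFq] at hpq
    exact G.P.e.injOn hps hqs hpq

/-! #### The diffeomorphism onto a union of components -/

variable [T2Space Q] [CompactSpace Q] [T2Space M'] [IsManifold 𝓘(ℝ, E) ∞ M']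

omit [CompactSpace Q] [T2Space M'] in
/-- `F` is an immersion, hence a local diffeomorphism. [folklore] -/
theorem isLocalDiffeomorph_glueMap : IsLocalDiffeomorph 𝓘(ℝ, E) 𝓘(ℝ, E) ∞ G.glueMap := by
  haveI : FiniteDimensional ℝ E := .of_fact_finrank_eq_succ (K := ℝ) (V := E) n
  exact (isImmersion_of_injective_mfderiv G.contMDiff_glueMap one_le_infty' G.injective_mfderiv_glueMap).isLocalDiffeomorph_of_finrank_eq rfl

omit [CompactSpace Q] [T2Space M'] in
/-- The image of `F` is open. [folklore] -/
theorem isOpen_range_glueMap : IsOpen (range G.glueMap) := G.isLocalDiffeomorph_glueMap.isOpenMap.isOpen_range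

omit [IsManifold 𝓘(ℝ, E) ∞ M'] in
/-- The image of `F` is closed. [folklore] -/
theorem isClosed_range_glueMap : IsClosed (range G.glueMap) :=
  (isCompact_range G.contMDiff_glueMap.continuous).isClosed

/-- The image of `F`, an open submanifold of `M'`. [folklore] -/
def rangeOpens : TopologicalSpace.Opens M' := ⟨range G.glueMap, G.isOpen_range_glueMap⟩

/-- `F` corestricted to its image. [folklore] -/
def glueMapCod (p : Q) : G.rangeOpens := ⟨G.glueMap p, mem_range_self p⟩

omit [CompactSpace Q] [T2Space M'] in
/-- The corestriction is a bijective local diffeomorphism. [folklore] -/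
theorem isLocalDiffeomorph_glueMapCod : IsLocalDiffeomorph 𝓘(ℝ, E) 𝓘(ℝ, E) ∞ G.glueMapCod := by
  haveI : FiniteDimensional ℝ E := .of_fact_finrank_eq_succ (K := ℝ) (V := E) n
  have hsm : ContMDiff 𝓘(ℝ, E) 𝓘(ℝ, E) ∞ G.glueMapCod := (ContMDiff.subtypeVal_comp_iff _ _).1 G.contMDiff_glueMap
  have hinj : ∀ p, Injective (mfderiv 𝓘(ℝ, E) 𝓘(ℝ, E) G.glueMapCod p) := fun p => by
    have hval : MDifferentiableAt 𝓘(ℝ, E) 𝓘(ℝ, E) (Subtype.val : G.rangeOpens → M') (G.glueMapCod p) :=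
      (contMDiff_subtype_val (n := ∞)).mdifferentiableAt (by simp)
    have hk : MDifferentiableAt 𝓘(ℝ, E) 𝓘(ℝ, E) G.glueMapCod p := (hsm p).mdifferentiableAt (by simp)
    have hcomp := mfderiv_comp p hval hk
    have hinjF := G.injective_mfderiv_glueMap p
    rw [show G.glueMap = Subtype.val ∘ G.glueMapCod from rfl, hcomp] at hinjF
    exact Injective.of_comp hinjF
  exact (isImmersion_of_injective_mfderiv hsm one_le_infty' hinj).isLocalDiffeomorph_of_finrank_eq rfl

/-- **`Q` is diffeomorphic to the image of `F`.** [folklore] -/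
def diffeomorphRange : Q ≃ₘ⟮𝓘(ℝ, E), 𝓘(ℝ, E)⟯ G.rangeOpens :=
  G.isLocalDiffeomorph_glueMapCod.diffeomorphOfBijective
    ⟨fun _ _ h => G.injective_glueMap (congrArg Subtype.val h), fun ⟨_, p, hp⟩ => ⟨p, Subtype.ext hp⟩⟩

omit hIt hIb in
/-- **A reconstruction datum without tubes and unmatched balls identifies `Q` with an open and
closed submanifold of `M'`** (a union of components; a component when `Q` is connected).
[cite: Hamilton1997, §1.1 pp. 3–4] -/
theorem exists_diffeomorph_opens (hIt' : IsEmpty G.P.It) (hIb' : IsEmpty G.P.Ib) :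
    ∃ C : TopologicalSpace.Opens M', IsClosed (C : Set M') ∧ Nonempty (Q ≃ₘ⟮𝓘(ℝ, E), 𝓘(ℝ, E)⟯ C) :=
  ⟨G.rangeOpens, G.isClosed_range_glueMap, ⟨G.diffeomorphRange⟩⟩

end SurgeryGlueData

end Literature.Topology.FourManifolds

end
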